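import Literature.Computability.AlgebraicComplexity.LickteigBorderSubstitution
import Literature.Computability.AlgebraicComplexity.BorderRankMatMulSmall223Proofs
import Literature.Computability.AlgebraicComplexity.BorderRankMatMulThreeHalves
import HarnessLib

/-!
# Kernel border-rank FLOORS for every format `⟨k,m,n⟩`, `2 ≤ k ≤ m ≤ n ≤ 5` (census cells, derived)

Topic `Summits/MatrixMultiplication/OmegaCensus/SmallFormats` (cell pub-omega, family (a), border-rank
column of the small-format census).  Framing: lottery ticket; floor = certified bounds/negative ranges.
These are DERIVED cells (hence under `Summits/`): for each format the best LOWER bound on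
`R̲(⟨k,m,n⟩)` over a field of characteristic `0` that follows by one line from tools PROVED in the tree —
flattenings (`mul_le_algBorderRank_matMulTensor_right`), the `p = 1` Koszul flattening
`3nm ≤ 2·R̲(⟨n,m,n⟩)` (`three_mul_mul_le_two_mul_algBorderRank_matMulTensor`, Landsberg–Ottaviani),
Landsberg–Ottaviani's `2n² − n ≤ R̲(⟨n,n,n⟩)`, rotation invariance
(`algBorderRank_matMulTensor_rotate`) and Lickteig's increment `R̲(⟨l,m,n⟩) + 1 ≤ R̲(⟨l+1,m,n⟩)`
(`algBorderRank_matMulTensor_succ_le`, `LickteigBorderSubstitution.lean`).  They are FLOORS of the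
kernel, weaker than the printed state of the art where one exists (CHL 2023: `R̲(⟨2,2,3⟩) = 10`,
`R̲(⟨2,3,3⟩) = 14`, `R̲(⟨2,n,n⟩) ≥ n² + … `, `R̲(⟨3,n,n⟩) ≥ n² + 2n − 1`; LM18: `R̲(⟨4,4,4⟩) ≥ 29`; those are
named facts in `BorderRankMatMulRectangular.lean` / `BorderRankMatMulSmall.lean`), and are recorded so the
census can quote a KERNEL interval `[floor, ceiling]` per format next to the kernel ceilings
(`BorderRankMatMul*.lean`, `BorderRank235Additive.lean`, `BorderRank455Additive.lean`).

| format | floor here | by | kernel ceiling (tree) |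
|---|---|---|---|
| 223 | 9 (`nine_le_algBorderRank_matMulTensor_223`) | Koszul | 10 |
| 224 | 12 | Koszul `⟨2,4,2⟩` | 13 |
| 225 | 15 | Koszul `⟨2,5,2⟩` | 16 |
| 233 | 10 | 223 + Lickteig | 14 |
| 234 | 13 | 224 + Lickteig | — (R = 20) |
| 235 | 16 | 225 + Lickteig | 24 |
| 244 | 17 | flattening 16 + Lickteig | 24 |
| 245 | 21 | flattening 20 + Lickteig | — (R = 32) |
| 255 | 26 | flattening 25 + Lickteig | 37 |
| 333 | 15 (`fifteen_le_algBorderRank_matMulTensor_three`) | LO15 | 20 |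
| 334 | 18 | Koszul `⟨3,4,3⟩` | 27 |
| 335 | 23 | Koszul `⟨3,5,3⟩` | 34 |
| 344 | 19 | 334 + Lickteig | — (R = 38) |
| 345 | 24 | 335 + Lickteig | — (R = 47) |
| 355 | 27 | 255 + Lickteig | — (R = 58) |
| 444 | 28 (`twentyeight_le_algBorderRank_matMulTensor_four`) | LO15 | 46 |
| 445 | 30 | Koszul `⟨4,5,4⟩` | — (R = 61) |
| 455 | 31 | Koszul `⟨4,5,4⟩` + Lickteig | 74 |
| 555 | 45 (`LandsbergOttaviani2015_algBorderRank_matMulTensor 5`) | LO15 | 89 |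

## References

* [LandsbergOttaviani2015] J. M. Landsberg, G. Ottaviani, Theory Comput. 11 (2015) 285–298 — Thm 2.1
  and the `p = 1` case (Strassen's equations), in tree.
* [Lickteig1984] T. Lickteig, Inform. Process. Lett. 18 (1984) 173–178 — the increment, in tree
  (`LickteigBorderSubstitution.lean`, after CHL 2023 §9).
* [ConnerHarperLandsberg2023] Forum Math. Pi 11 (2023) e17 — the printed values quoted above.
-/

noncomputable section

namespace Summit.MatrixMultiplication.OmegaCensus.BorderRankLowerCells

open Literature.Computability.AlgebraicComplexity

universe u

variable (K : Type u) [Field K] [CharZero K]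

/-- `3n ≤ R̲(⟨2,2,n⟩)` in characteristic `0` (Koszul `p = 1` at `⟨2,n,2⟩`, rotated).
[cite: LandsbergOttaviani2015, Thm 2.1 (p = 1)] -/
theorem three_mul_le_algBorderRank_matMulTensor_22n (n : ℕ) :
    3 * n ≤ algBorderRank (matMulTensor K 2 2 n) := by
  have h := three_mul_mul_le_two_mul_algBorderRank_matMulTensor K 2 n le_rfl
  rw [algBorderRank_matMulTensor_rotate K 2 2 n]
  omega

omit [CharZero K] in
/-- Lickteig's increment in the MIDDLE slot: `R̲(⟨k,m,n⟩) + 1 ≤ R̲(⟨k,m+1,n⟩)` (`k, n ≥ 1`), by rotation.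
[cite: Lickteig1984, main result, as reproved in ConnerHarperLandsberg2023 §9] -/
theorem algBorderRank_matMulTensor_succ_mid_le (k m n : ℕ) (hk : 1 ≤ k) (hn : 1 ≤ n) :
    algBorderRank (matMulTensor K k m n) + 1 ≤ algBorderRank (matMulTensor K k (m + 1) n) := by
  have h := algBorderRank_matMulTensor_succ_le K m n k hn hk
  rwa [← algBorderRank_matMulTensor_rotate K k m n,
    ← algBorderRank_matMulTensor_rotate K k (m + 1) n] at h

/-- `12 ≤ R̲(⟨2,2,4⟩)`. [cite: LandsbergOttaviani2015, Thm 2.1 (p = 1)] -/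
theorem twelve_le_algBorderRank_matMulTensor_224 : 12 ≤ algBorderRank (matMulTensor K 2 2 4) := by
  simpa using three_mul_le_algBorderRank_matMulTensor_22n K 4

/-- `15 ≤ R̲(⟨2,2,5⟩)`. [cite: LandsbergOttaviani2015, Thm 2.1 (p = 1)] -/
theorem fifteen_le_algBorderRank_matMulTensor_225 : 15 ≤ algBorderRank (matMulTensor K 2 2 5) := by
  simpa using three_mul_le_algBorderRank_matMulTensor_22n K 5

/-- `10 ≤ R̲(⟨2,3,3⟩)` (`9 ≤ R̲(⟨2,2,3⟩)` + Lickteig). [cite: Lickteig1984, main result] -/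
theorem ten_le_algBorderRank_matMulTensor_233 : 10 ≤ algBorderRank (matMulTensor K 2 3 3) := by
  have h1 := nine_le_algBorderRank_matMulTensor_223 K
  have h2 : algBorderRank (matMulTensor K 2 2 3) + 1 ≤
      algBorderRank (matMulTensor K 2 3 3) :=
    algBorderRank_matMulTensor_succ_mid_le K 2 2 3 (by norm_num) (by norm_num)
  omega

/-- `13 ≤ R̲(⟨2,3,4⟩)`. [cite: Lickteig1984, main result] -/
theorem thirteen_le_algBorderRank_matMulTensor_234 : 13 ≤ algBorderRank (matMulTensor K 2 3 4) := by
  have h1 := twelve_le_algBorderRank_matMulTensor_224 K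
  have h2 : algBorderRank (matMulTensor K 2 2 4) + 1 ≤
      algBorderRank (matMulTensor K 2 3 4) :=
    algBorderRank_matMulTensor_succ_mid_le K 2 2 4 (by norm_num) (by norm_num)
  omega

/-- `16 ≤ R̲(⟨2,3,5⟩)`. [cite: Lickteig1984, main result] -/
theorem sixteen_le_algBorderRank_matMulTensor_235 : 16 ≤ algBorderRank (matMulTensor K 2 3 5) := by
  have h1 := fifteen_le_algBorderRank_matMulTensor_225 K
  have h2 : algBorderRank (matMulTensor K 2 2 5) + 1 ≤
      algBorderRank (matMulTensor K 2 3 5) :=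
    algBorderRank_matMulTensor_succ_mid_le K 2 2 5 (by norm_num) (by norm_num)
  omega

omit [CharZero K] in
/-- `17 ≤ R̲(⟨2,4,4⟩)` (flattening `16 ≤ R̲(⟨1,4,4⟩)` + Lickteig; print: `22`, CHL Thm 1.4(2)).
[cite: Lickteig1984, as quoted in ConnerHarperLandsberg2023 §1 p. 4] -/
theorem seventeen_le_algBorderRank_matMulTensor_244 : 17 ≤ algBorderRank (matMulTensor K 2 4 4) := by
  have h1 := mul_le_algBorderRank_matMulTensor_right K 1 4 4
  have h2 : algBorderRank (matMulTensor K 1 4 4) + 1 ≤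
      algBorderRank (matMulTensor K 2 4 4) :=
    algBorderRank_matMulTensor_succ_le K 1 4 4 (by norm_num) (by norm_num)
  omega

omit [CharZero K] in
/-- `21 ≤ R̲(⟨2,4,5⟩)`. [cite: Lickteig1984, main result] -/
theorem twentyone_le_algBorderRank_matMulTensor_245 : 21 ≤ algBorderRank (matMulTensor K 2 4 5) := by
  have h1 := mul_le_algBorderRank_matMulTensor_right K 1 4 5
  have h2 : algBorderRank (matMulTensor K 1 4 5) + 1 ≤
      algBorderRank (matMulTensor K 2 4 5) :=
    algBorderRank_matMulTensor_succ_le K 1 4 5 (by norm_num) (by norm_num)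
  omega

omit [CharZero K] in
/-- `26 ≤ R̲(⟨2,5,5⟩)` (print: `32`, CHL Thm 1.4(2)). [cite: Lickteig1984, as quoted in ConnerHarperLandsberg2023 §1 p. 4] -/
theorem twentysix_le_algBorderRank_matMulTensor_255 : 26 ≤ algBorderRank (matMulTensor K 2 5 5) := by
  have h1 := mul_le_algBorderRank_matMulTensor_right K 1 5 5
  have h2 : algBorderRank (matMulTensor K 1 5 5) + 1 ≤
      algBorderRank (matMulTensor K 2 5 5) :=
    algBorderRank_matMulTensor_succ_le K 1 5 5 (by norm_num) (by norm_num)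
  omega

/-- `18 ≤ R̲(⟨3,3,4⟩)` (Koszul at `⟨3,4,3⟩`, rotated). [cite: LandsbergOttaviani2015, Thm 2.1 (p = 1)] -/
theorem eighteen_le_algBorderRank_matMulTensor_334 : 18 ≤ algBorderRank (matMulTensor K 3 3 4) := by
  have h := three_mul_mul_le_two_mul_algBorderRank_matMulTensor K 3 4 (by norm_num)
  rw [← algBorderRank_matMulTensor_rotate K 3 3 4] at h
  omega

/-- `23 ≤ R̲(⟨3,3,5⟩)` (Koszul at `⟨3,5,3⟩`: `45 ≤ 2·R̲`). [cite: LandsbergOttaviani2015, Thm 2.1 (p = 1)] -/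
theorem twentythree_le_algBorderRank_matMulTensor_335 : 23 ≤ algBorderRank (matMulTensor K 3 3 5) := by
  have h := three_mul_mul_le_two_mul_algBorderRank_matMulTensor K 3 5 (by norm_num)
  rw [← algBorderRank_matMulTensor_rotate K 3 3 5] at h
  omega

/-- `19 ≤ R̲(⟨3,4,4⟩)` (`334` + Lickteig; print: `23`, CHL Thm 1.5). [cite: Lickteig1984, main result] -/
theorem nineteen_le_algBorderRank_matMulTensor_344 : 19 ≤ algBorderRank (matMulTensor K 3 4 4) := by
  have h1 := eighteen_le_algBorderRank_matMulTensor_334 K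
  have h2 : algBorderRank (matMulTensor K 3 3 4) + 1 ≤
      algBorderRank (matMulTensor K 3 4 4) :=
    algBorderRank_matMulTensor_succ_mid_le K 3 3 4 (by norm_num) (by norm_num)
  omega

/-- `24 ≤ R̲(⟨3,4,5⟩)`. [cite: Lickteig1984, main result] -/
theorem twentyfour_le_algBorderRank_matMulTensor_345 : 24 ≤ algBorderRank (matMulTensor K 3 4 5) := by
  have h1 := twentythree_le_algBorderRank_matMulTensor_335 K
  have h2 : algBorderRank (matMulTensor K 3 3 5) + 1 ≤
      algBorderRank (matMulTensor K 3 4 5) :=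
    algBorderRank_matMulTensor_succ_mid_le K 3 3 5 (by norm_num) (by norm_num)
  omega

omit [CharZero K] in
/-- `27 ≤ R̲(⟨3,5,5⟩)` (`255` + Lickteig; print: `34`, CHL Thm 1.5). [cite: Lickteig1984, main result] -/
theorem twentyseven_le_algBorderRank_matMulTensor_355 : 27 ≤ algBorderRank (matMulTensor K 3 5 5) := by
  have h1 := twentysix_le_algBorderRank_matMulTensor_255 K
  have h2 : algBorderRank (matMulTensor K 2 5 5) + 1 ≤
      algBorderRank (matMulTensor K 3 5 5) :=
    algBorderRank_matMulTensor_succ_le K 2 5 5 (by norm_num) (by norm_num)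
  omega

/-- `30 ≤ R̲(⟨4,4,5⟩)` (Koszul at `⟨4,5,4⟩`: `60 ≤ 2·R̲`). [cite: LandsbergOttaviani2015, Thm 2.1 (p = 1)] -/
theorem thirty_le_algBorderRank_matMulTensor_445 : 30 ≤ algBorderRank (matMulTensor K 4 4 5) := by
  have h := three_mul_mul_le_two_mul_algBorderRank_matMulTensor K 4 5 (by norm_num)
  rw [← algBorderRank_matMulTensor_rotate K 4 4 5] at h
  omega

/-- `31 ≤ R̲(⟨4,5,5⟩)` (`30 ≤ R̲(⟨4,5,4⟩)` + Lickteig, rotated). [cite: Lickteig1984, main result] -/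
theorem thirtyone_le_algBorderRank_matMulTensor_455 : 31 ≤ algBorderRank (matMulTensor K 4 5 5) := by
  have h1 := three_mul_mul_le_two_mul_algBorderRank_matMulTensor K 4 5 (by norm_num)
  have h2 : algBorderRank (matMulTensor K 4 5 4) + 1 ≤ algBorderRank (matMulTensor K 5 5 4) :=
    algBorderRank_matMulTensor_succ_le K 4 5 4 (by norm_num) (by norm_num)
  rw [algBorderRank_matMulTensor_rotate K 4 5 5]
  omega

/-- `45 ≤ R̲(⟨5,5,5⟩)` (Landsberg–Ottaviani `2n² − n`). [cite: LandsbergOttaviani2015, Thm 1.2] -/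
theorem fortyfive_le_algBorderRank_matMulTensor_555 : 45 ≤ algBorderRank (matMulTensor K 5 5 5) := by
  simpa using LandsbergOttaviani2015_algBorderRank_matMulTensor K 5 (by norm_num)

end Summit.MatrixMultiplication.OmegaCensus.BorderRankLowerCells

end
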